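import Summits.Ventures.WeilGRH.RigiditySechA1S80
import HarnessLib

/-!
# rh-explicit (venture WeilGRH): the `sech` bonus tables of the `a = 1` (scale `2^80`) rung — diagonal kernel check, range `5 ≤ n < 7` (weil-3 gen19)

Cell `rh-explicit`, WEIL TRACK (structure seat weil-3, gen19; GRH-arm cross-over).  Part D3 of the `a = 1` `sech` data (`RigiditySechA1S80`): the literal
diagonal table `dtabPF` re-computed by `checkDiagTabH` (`K = 512` + half term, `Karc = 96`) on the modes `5 ≤ n < 7` (≈ 60 s of kernel time per
entry at this window, hence the split).  The validity statement is assembled in `RigiditySechA1S80B`.  Pure kernel check; no named facts; RH/GRH-free;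
standard axioms; nothing here bears on the truth of RH or GRH.
-/

set_option linter.dupNamespace false
set_option maxRecDepth 200000
set_option autoImplicit false

namespace Summit.Ventures.WeilGRH.Christoffel.A1S80

open Literature.NumberTheory.LFunctions Literature.NumberTheory.LFunctions.Yoshida1992 Encl
  Literature.Analysis.ValidatedNumerics.NumericsMP
open Summit.Ventures.WeilGRH.TwistedEncl Summit.Ventures.WeilGRH.SechEncl

set_option maxHeartbeats 0 in
/-- kernel: the diagonal table re-computed and compared on `5 ≤ n < 7` (`K = 512`, `Karc = 96`). -/
theorem check_diagTab_3 : checkDiagTabH (2 ^ 80) 96 C.P C.A EApf E0pf Rpf 512 5 7 dtabPF = true := by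
  decide +kernel

end Summit.Ventures.WeilGRH.Christoffel.A1S80
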